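import Literature.MathematicalPhysics.QuantumFieldTheory.Balaban1983to89.B9Thm315WholeSectERep

/-!
# `Balaban1983to89.B9Thm315WholeBlocksRect` — [B9] (3.169)∕(3.185) p. 430∕432: RECTANGULAR BLOCK CALCULUS for letters between two lattice-function
# carriers, the LOCALITY ALGEBRA of ranges and masses under composition, and the locality `LocalOuterY` of the outer factors `P_Λ(I + Dμ)P_Λ`,
# `P_Λ(I + μ*D*)P_Λ` of (3.185) FROM letter-level locality of `D`, `μ`, `μ*`, `D*`

T. Bałaban, *Propagators for lattice gauge theories in a background field*, Commun. Math. Phys. **99** (1985) 389–434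
[`Balaban1985BackgroundPropagators`, "B9"].

statement-level skeleton of published theorems with citation tags; proofs where landed; nothing here is a claim about the Yang–Mills mass gap

THE PRINTED LOCUS (verbatim).  p. 430, (3.168)–(3.169): *"This implies μ(y) = Q′(R_y(V)B)(Γ_{y,·}), μ(x) = R(V(Γ_{x,y}))Q′(R_y(V)B)(Γ_{y,·}) − R(V(Γ_{x,y}))
(R_y(V)B)(Γ_{y,x}), x ∈ B(y), x ≠ y. (3.169) We denote the linear function defined by the above formulas by μ(B)."*; p. 432: *"C^{(k)}(Λ) = (I + Dμ)QG̃₂Q*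
(I + μ*D*). (3.185) … The formula (3.185) implies immediately bounds and an exponential decay … with the constants B₀, δ₀ depending on d and L only."*
`μ(B)(x)` reads `B` on the bonds of the block `B(y) ∋ x` and of the contour `Γ_{y,x}` only; `D = D_V` is the one-step covariant derivative: both are
LOCAL (finite range in the k-block distance) with bounded block norms at `G`-valued `V` — the content of the locality schema `LocalOuterY` of the seat's
`B9Thm315WholeSectERep` (p503636), which def-Y g5 supplies at the Sect. E letters of record (`Node00/OpsYSectELetters`, announced).

THE POINT.  `LocalOuterY x 𝔢 r m_E m_F U` speaks about the blocks (`B9Thm315WholeBlocks.blockCLM`, square: index bonds × index bonds) of the COMPOSITES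
`P_Λ(1 + D∘μ)P_Λ`, `P_Λ(1 + μ*∘D*)P_Λ`, while the letters `μ : (bonds → 𝔸) → (sites → 𝔸)`, `D : (sites → 𝔸) → (bonds → 𝔸)` act BETWEEN two carriers.  THIS
FILE supplies the algebra that turns letter-level locality into `LocalOuterY`: §1 RECTANGULAR BLOCKS `blockCLM₂ T z w : 𝔸 →L[ℂ] 𝔸` of a ℂ-linear `T : (Y → 𝔸)
→ (X → 𝔸)` (`blockMat₂`, composition = rectangular matrix product `blockMat₂_comp`, sums, the identity, agreement with the square `blockCLM`, the reading
inequality); §2 THE LOCALITY ALGEBRA along placings `π_X, π_Y, π_Z` of the carriers into one pseudo-metric position space: ranges ADD under composition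
(`range_comp_le`), row masses and column masses MULTIPLY (`rowMass_comp_le`, `colMass_comp_le`), sums and the identity (`range_add`, `rowMass_add_le`,
`colMass_add_le`, `range_one`, `rowMass_one_le`, `colMass_one_le`), and sector sandwiches `P_S·T·P_S` do not increase either (`blockCLM_sec_sandwich`,
`norm_blockCLM_sec_sandwich_le`); §3 AT A MEMBER (positions = the k-block labels `Fin (d+1) → ℤ` with p21's `tdistK`, bonds placed by def-Y's `kLab x` — so
`ρ ∘ kLab = unitDistY` by `rfl` — and sites by a placing `πS` of the supplier's choice): ★★ `localOuterY_of_letters` — per-`U` range∕mass data of the four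
letters `𝔢.Dbar U`, `𝔢.mu U`, `𝔢.muT U`, `𝔢.DbarT U` give `LocalOuterY x 𝔢 r (1 + m_D m_μ) (1 + m_{μ*} m_{D*}) U` with `r = max 0 (max (r_D + r_μ)
(r_{μ*} + r_{D*}))`.

HONEST SCOPE.  Finite-dimensional linear algebra and bookkeeping of supports; no inequality of the paper.  The letter-level locality stays a HYPOTHESIS
(def-Y's Sect. E letters of record are being typed); nothing of print asserted; NOT a node discharge (N06 unmoved), NOT summit progress; one finite
lattice programme at fixed ε; nothing continuum ∕ ℝ⁴ ∕ OS ∕ mass gap ∕ Clay.  Cell `pub-ymgap` (D-0062), node N06 [B9], bundle F8 row 24 (successor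
file), seat `pub-ymgap-dag-n06-m` (g4), 2026-08-27.  Imports the seat's `B9Thm315WholeSectERep` (hence `B9Thm315WholeBlocks`, `Node00.OpsYRecordV4`);
nothing restated.  Net new unproved facts: 0.
-/

noncomputable section

namespace Literature.MathematicalPhysics.QuantumFieldTheory.Balaban1983to89.B9Thm315WholeBlocksRect

open Node00 (deltaY BallY ballY_nonempty secY secY_apply_of secY_apply_of_not)
open B4Sect5Torus (IsPseudoDist)
open B9Thm315WholeBlocks (deltaY_add deltaY_smul sum_deltaY blockCLM blockMat blockCLM_apply blockMat_apply)
open scoped Matrix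

/-! ## §1 Rectangular blocks of a ℂ-linear map `(Y → 𝔸) → (X → 𝔸)` -/

section Blocks

variable {𝔸 : Type} [NormedRing 𝔸] [NormedAlgebra ℂ 𝔸] {X Y Z : Type}

/-- **THE (z, w)-BLOCK OF A ℂ-LINEAR MAP BETWEEN TWO CARRIERS** `T : (Y → 𝔸) → (X → 𝔸)`: the endomorphism `a ↦ (T(δ_w ⊗ a))(z)` of `𝔸` (`z ∈ X`, `w ∈ Y`),
as a linear map. [cite: Balaban1985BackgroundPropagators, p.390 («|·| is the block norm»), (3.169) p.430 (μ between bond and site functions), dictionary] -/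
def blockLM₂ (T : (Y → 𝔸) →ₗ[ℂ] (X → 𝔸)) (z : X) (w : Y) : 𝔸 →ₗ[ℂ] 𝔸 where
  toFun a := T (deltaY w a) z
  map_add' a b := by rw [deltaY_add, map_add]; rfl
  map_smul' c a := by rw [deltaY_smul, map_smul]; rfl

variable [FiniteDimensional ℂ 𝔸]

/-- **THE RECTANGULAR BLOCK AS A BOUNDED OPERATOR** (finite dimension), an element of `𝔸 →L[ℂ] 𝔸`. [cite: Balaban1985BackgroundPropagators, p.390, dictionary] -/
def blockCLM₂ (T : (Y → 𝔸) →ₗ[ℂ] (X → 𝔸)) (z : X) (w : Y) : 𝔸 →L[ℂ] 𝔸 :=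
  LinearMap.toContinuousLinearMap (blockLM₂ T z w)

/-- the block, evaluated. [cite: Balaban1985BackgroundPropagators, p.390, dictionary] -/
@[simp] theorem blockCLM₂_apply (T : (Y → 𝔸) →ₗ[ℂ] (X → 𝔸)) (z : X) (w : Y) (a : 𝔸) : blockCLM₂ T z w a = T (deltaY w a) z := rfl

/-- **THE RECTANGULAR BLOCK MATRIX** of `T` (rows `X`, columns `Y`, entries in `𝔸 →L[ℂ] 𝔸`). [cite: Balaban1985BackgroundPropagators, p.390, dictionary] -/
def blockMat₂ (T : (Y → 𝔸) →ₗ[ℂ] (X → 𝔸)) : Matrix X Y (𝔸 →L[ℂ] 𝔸) := Matrix.of fun z w => blockCLM₂ T z w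

/-- the block matrix, evaluated. [cite: Balaban1985BackgroundPropagators, p.390, dictionary] -/
@[simp] theorem blockMat₂_apply (T : (Y → 𝔸) →ₗ[ℂ] (X → 𝔸)) (z : X) (w : Y) : blockMat₂ T z w = blockCLM₂ T z w := rfl

/-- on ONE carrier the rectangular block IS the seat's square block `B9Thm315WholeBlocks.blockCLM` (`rfl`). [cite: Balaban1985BackgroundPropagators, p.390, bookkeeping] -/
theorem blockCLM₂_eq_blockCLM (T : (X → 𝔸) →ₗ[ℂ] (X → 𝔸)) (z w : X) : blockCLM₂ T z w = blockCLM T z w := rfl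

/-- … and so is the block matrix. [cite: Balaban1985BackgroundPropagators, p.390, bookkeeping] -/
theorem blockMat₂_eq_blockMat (T : (X → 𝔸) →ₗ[ℂ] (X → 𝔸)) : blockMat₂ T = blockMat T := rfl

/-- **BLOCKS OF A COMPOSITION = THE RECTANGULAR MATRIX PRODUCT OF THE BLOCKS** (summed over the middle carrier).
[cite: Balaban1985BackgroundPropagators, (3.185) p.432 ((I + Dμ) as a composite), bookkeeping] -/
theorem blockMat₂_comp [Fintype Y] (T : (Y → 𝔸) →ₗ[ℂ] (X → 𝔸)) (S : (Z → 𝔸) →ₗ[ℂ] (Y → 𝔸)) :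
    blockMat₂ (T ∘ₗ S) = blockMat₂ T * blockMat₂ S := by
  classical
  ext z w a
  have hmul : ∀ v, (blockCLM₂ T z v * blockCLM₂ S v w) a = T (deltaY v (S (deltaY w a) v)) z := fun v => rfl
  rw [Matrix.mul_apply, FunLike.coe_sum, Finset.sum_apply]
  simp only [blockMat₂_apply, hmul, blockCLM₂_apply, LinearMap.comp_apply]
  conv_lhs => rw [← sum_deltaY (S (deltaY w a))]
  rw [map_sum, Finset.sum_apply]

/-- blocks of a composition, entrywise. [cite: Balaban1985BackgroundPropagators, (3.185) p.432, bookkeeping] -/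
theorem blockCLM₂_comp [Fintype Y] (T : (Y → 𝔸) →ₗ[ℂ] (X → 𝔸)) (S : (Z → 𝔸) →ₗ[ℂ] (Y → 𝔸)) (z : X) (w : Z) :
    blockCLM₂ (T ∘ₗ S) z w = ∑ v, blockCLM₂ T z v * blockCLM₂ S v w := by
  have h := congrFun (congrFun (blockMat₂_comp T S) z) w
  rwa [blockMat₂_apply, Matrix.mul_apply] at h

/-- blocks of a sum. [cite: Balaban1985BackgroundPropagators, (3.185) p.432 (I + Dμ), bookkeeping] -/
theorem blockCLM₂_add (T S : (Y → 𝔸) →ₗ[ℂ] (X → 𝔸)) (z : X) (w : Y) : blockCLM₂ (T + S) z w = blockCLM₂ T z w + blockCLM₂ S z w := by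
  ext a; rfl

open Classical in
/-- blocks of the identity: `δ_{zw}·id`. [cite: Balaban1985BackgroundPropagators, (3.185) p.432 (the I of I + Dμ), bookkeeping] -/
theorem blockCLM₂_one (z w : X) : blockCLM₂ (1 : Module.End ℂ (X → 𝔸)) z w = if z = w then (1 : 𝔸 →L[ℂ] 𝔸) else 0 := by
  ext a
  rw [blockCLM₂_apply, Module.End.one_apply]
  by_cases h : z = w
  · subst h; simp [deltaY]
  · simp [deltaY, h]

/-- **THE READING INEQUALITY** (rectangular): the sup over the closed unit ball of `‖(T(δ_w ⊗ E))(z)‖` is at most the operator norm of the block.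
[cite: Balaban1985BackgroundPropagators, (3.187) p.432 + p.390] -/
theorem abs_iSup_ball_le_norm_blockCLM₂ [CompleteSpace 𝔸] (T : (Y → 𝔸) →ₗ[ℂ] (X → 𝔸)) (z : X) (w : Y) :
    |⨆ E : BallY 𝔸, ‖T (deltaY w (E : 𝔸)) z‖| ≤ ‖blockCLM₂ T z w‖ := by
  haveI : Nonempty (BallY 𝔸) := ballY_nonempty
  have hle : ∀ E : BallY 𝔸, ‖T (deltaY w (E : 𝔸)) z‖ ≤ ‖blockCLM₂ T z w‖ := fun E => by
    have hE : ‖(E : 𝔸)‖ ≤ 1 := mem_closedBall_zero_iff.1 E.2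
    calc ‖T (deltaY w (E : 𝔸)) z‖ = ‖blockCLM₂ T z w (E : 𝔸)‖ := rfl
      _ ≤ ‖blockCLM₂ T z w‖ * ‖(E : 𝔸)‖ := (blockCLM₂ T z w).le_opNorm _
      _ ≤ ‖blockCLM₂ T z w‖ * 1 := mul_le_mul_of_nonneg_left hE (norm_nonneg _)
      _ = ‖blockCLM₂ T z w‖ := mul_one _
  rw [abs_of_nonneg (Real.iSup_nonneg fun E => norm_nonneg _)]
  exact ciSup_le hle

/-- the entry inequality `‖(T(δ_w ⊗ a))(z)‖ ≤ ‖block(z, w)‖·‖a‖`. [cite: Balaban1985BackgroundPropagators, p.390, bookkeeping] -/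
theorem norm_apply_deltaY_le (T : (Y → 𝔸) →ₗ[ℂ] (X → 𝔸)) (z : X) (w : Y) (a : 𝔸) : ‖T (deltaY w a) z‖ ≤ ‖blockCLM₂ T z w‖ * ‖a‖ :=
  (blockCLM₂ T z w).le_opNorm a

end Blocks

/-! ## §2 The locality algebra: ranges add, masses multiply, sums, identity, sector sandwiches -/

section Locality

variable {𝔸 : Type} [NormedRing 𝔸] [NormedAlgebra ℂ 𝔸] [FiniteDimensional ℂ 𝔸] {X Y Z Pos : Type} {ρ : Pos → Pos → ℝ}

/-- **RANGES ADD UNDER COMPOSITION** (along placings of the three carriers into one pseudo-metric position space): if the `(z, v)` block of `T`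
vanishes unless `ρ(π_X z, π_Y v) ≤ r₁` and the `(v, w)` block of `S` vanishes unless `ρ(π_Y v, π_Z w) ≤ r₂`, then the `(z, w)` block of `T ∘ S` vanishes
unless `ρ(π_X z, π_Z w) ≤ r₁ + r₂`. [cite: Balaban1985BackgroundPropagators, (3.169) p.430 (local μ), (3.185) p.432, bookkeeping] -/
theorem range_comp_le [Fintype Y] (hρ : IsPseudoDist ρ) (πX : X → Pos) (πY : Y → Pos) (πZ : Z → Pos)
    {T : (Y → 𝔸) →ₗ[ℂ] (X → 𝔸)} {S : (Z → 𝔸) →ₗ[ℂ] (Y → 𝔸)} {r₁ r₂ : ℝ}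
    (hT : ∀ z v, blockCLM₂ T z v ≠ 0 → ρ (πX z) (πY v) ≤ r₁) (hS : ∀ v w, blockCLM₂ S v w ≠ 0 → ρ (πY v) (πZ w) ≤ r₂)
    (z : X) (w : Z) (h : blockCLM₂ (T ∘ₗ S) z w ≠ 0) : ρ (πX z) (πZ w) ≤ r₁ + r₂ := by
  rw [blockCLM₂_comp] at h
  obtain ⟨v, -, hv⟩ := Finset.exists_ne_zero_of_sum_ne_zero h
  have hT' : blockCLM₂ T z v ≠ 0 := fun h0 => hv (by rw [h0, zero_mul])
  have hS' : blockCLM₂ S v w ≠ 0 := fun h0 => hv (by rw [h0, mul_zero])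
  exact (hρ.triangle _ (πY v) _).trans (add_le_add (hT z v hT') (hS v w hS'))

/-- **ROW MASSES MULTIPLY**: `Σ_w ‖block(T∘S)(z, w)‖ ≤ m₁·m₂` from the row masses `≤ m₁` of `T` and `≤ m₂` of `S` (`m₂ ≥ 0`).
[cite: Balaban1985BackgroundPropagators, (3.185) p.432, bookkeeping] -/
theorem rowMass_comp_le [Fintype Y] [Fintype Z] {T : (Y → 𝔸) →ₗ[ℂ] (X → 𝔸)} {S : (Z → 𝔸) →ₗ[ℂ] (Y → 𝔸)} {m₁ m₂ : ℝ} (hm₂ : 0 ≤ m₂)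
    (hT : ∀ z, ∑ v, ‖blockCLM₂ T z v‖ ≤ m₁) (hS : ∀ v, ∑ w, ‖blockCLM₂ S v w‖ ≤ m₂) (z : X) :
    ∑ w, ‖blockCLM₂ (T ∘ₗ S) z w‖ ≤ m₁ * m₂ := by
  calc ∑ w, ‖blockCLM₂ (T ∘ₗ S) z w‖ ≤ ∑ w, ∑ v, ‖blockCLM₂ T z v‖ * ‖blockCLM₂ S v w‖ :=
        Finset.sum_le_sum fun w _ => by
          rw [blockCLM₂_comp]
          exact (norm_sum_le _ _).trans (Finset.sum_le_sum fun v _ => norm_mul_le _ _)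
    _ = ∑ v, ‖blockCLM₂ T z v‖ * ∑ w, ‖blockCLM₂ S v w‖ := by rw [Finset.sum_comm]; simp only [Finset.mul_sum]
    _ ≤ ∑ v, ‖blockCLM₂ T z v‖ * m₂ := Finset.sum_le_sum fun v _ => mul_le_mul_of_nonneg_left (hS v) (norm_nonneg _)
    _ = (∑ v, ‖blockCLM₂ T z v‖) * m₂ := by rw [Finset.sum_mul]
    _ ≤ m₁ * m₂ := mul_le_mul_of_nonneg_right (hT z) hm₂

/-- **COLUMN MASSES MULTIPLY**: `Σ_z ‖block(T∘S)(z, w)‖ ≤ m₁·m₂` from the column masses `≤ m₁` of `T` (`m₁ ≥ 0`) and `≤ m₂` of `S`.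
[cite: Balaban1985BackgroundPropagators, (3.185) p.432, bookkeeping] -/
theorem colMass_comp_le [Fintype X] [Fintype Y] {T : (Y → 𝔸) →ₗ[ℂ] (X → 𝔸)} {S : (Z → 𝔸) →ₗ[ℂ] (Y → 𝔸)} {m₁ m₂ : ℝ} (hm₁ : 0 ≤ m₁)
    (hT : ∀ v, ∑ z, ‖blockCLM₂ T z v‖ ≤ m₁) (hS : ∀ w, ∑ v, ‖blockCLM₂ S v w‖ ≤ m₂) (w : Z) :
    ∑ z, ‖blockCLM₂ (T ∘ₗ S) z w‖ ≤ m₁ * m₂ := by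
  calc ∑ z, ‖blockCLM₂ (T ∘ₗ S) z w‖ ≤ ∑ z, ∑ v, ‖blockCLM₂ T z v‖ * ‖blockCLM₂ S v w‖ :=
        Finset.sum_le_sum fun z _ => by
          rw [blockCLM₂_comp]
          exact (norm_sum_le _ _).trans (Finset.sum_le_sum fun v _ => norm_mul_le _ _)
    _ = ∑ v, (∑ z, ‖blockCLM₂ T z v‖) * ‖blockCLM₂ S v w‖ := by rw [Finset.sum_comm]; simp only [Finset.sum_mul]
    _ ≤ ∑ v, m₁ * ‖blockCLM₂ S v w‖ := Finset.sum_le_sum fun v _ => mul_le_mul_of_nonneg_right (hT v) (norm_nonneg _)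
    _ = m₁ * ∑ v, ‖blockCLM₂ S v w‖ := by rw [Finset.mul_sum]
    _ ≤ m₁ * m₂ := mul_le_mul_of_nonneg_left (hS w) hm₁

/-- ranges of a sum: the larger of the two. [cite: Balaban1985BackgroundPropagators, (3.185) p.432 (I + Dμ), bookkeeping] -/
theorem range_add (πX : X → Pos) (πY : Y → Pos) {T S : (Y → 𝔸) →ₗ[ℂ] (X → 𝔸)} {r₁ r₂ : ℝ}
    (hT : ∀ z w, blockCLM₂ T z w ≠ 0 → ρ (πX z) (πY w) ≤ r₁) (hS : ∀ z w, blockCLM₂ S z w ≠ 0 → ρ (πX z) (πY w) ≤ r₂)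
    (z : X) (w : Y) (h : blockCLM₂ (T + S) z w ≠ 0) : ρ (πX z) (πY w) ≤ max r₁ r₂ := by
  rw [blockCLM₂_add] at h
  by_cases hT0 : blockCLM₂ T z w = 0
  · rw [hT0, zero_add] at h
    exact (hS z w h).trans (le_max_right _ _)
  · exact (hT z w hT0).trans (le_max_left _ _)

/-- row masses of a sum add. [cite: Balaban1985BackgroundPropagators, (3.185) p.432, bookkeeping] -/
theorem rowMass_add_le [Fintype Y] {T S : (Y → 𝔸) →ₗ[ℂ] (X → 𝔸)} {m₁ m₂ : ℝ} (hT : ∀ z, ∑ w, ‖blockCLM₂ T z w‖ ≤ m₁)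
    (hS : ∀ z, ∑ w, ‖blockCLM₂ S z w‖ ≤ m₂) (z : X) : ∑ w, ‖blockCLM₂ (T + S) z w‖ ≤ m₁ + m₂ := by
  calc ∑ w, ‖blockCLM₂ (T + S) z w‖ ≤ ∑ w, (‖blockCLM₂ T z w‖ + ‖blockCLM₂ S z w‖) :=
        Finset.sum_le_sum fun w _ => by rw [blockCLM₂_add]; exact norm_add_le _ _
    _ ≤ m₁ + m₂ := by rw [Finset.sum_add_distrib]; exact add_le_add (hT z) (hS z)

/-- column masses of a sum add. [cite: Balaban1985BackgroundPropagators, (3.185) p.432, bookkeeping] -/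
theorem colMass_add_le [Fintype X] {T S : (Y → 𝔸) →ₗ[ℂ] (X → 𝔸)} {m₁ m₂ : ℝ} (hT : ∀ w, ∑ z, ‖blockCLM₂ T z w‖ ≤ m₁)
    (hS : ∀ w, ∑ z, ‖blockCLM₂ S z w‖ ≤ m₂) (w : Y) : ∑ z, ‖blockCLM₂ (T + S) z w‖ ≤ m₁ + m₂ := by
  calc ∑ z, ‖blockCLM₂ (T + S) z w‖ ≤ ∑ z, (‖blockCLM₂ T z w‖ + ‖blockCLM₂ S z w‖) :=
        Finset.sum_le_sum fun z _ => by rw [blockCLM₂_add]; exact norm_add_le _ _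
    _ ≤ m₁ + m₂ := by rw [Finset.sum_add_distrib]; exact add_le_add (hT w) (hS w)

/-- the identity has range `0`. [cite: Balaban1985BackgroundPropagators, (3.185) p.432 (the I), bookkeeping] -/
theorem range_one (hρ : IsPseudoDist ρ) (πX : X → Pos) (z w : X) (h : blockCLM₂ (1 : Module.End ℂ (X → 𝔸)) z w ≠ 0) :
    ρ (πX z) (πX w) ≤ 0 := by
  by_cases hzw : z = w
  · rw [hzw, hρ.zero]
  · rw [blockCLM₂_one, if_neg hzw] at h
    exact absurd rfl h

open Classical in
/-- the identity has row mass `≤ 1`. [cite: Balaban1985BackgroundPropagators, (3.185) p.432, bookkeeping] -/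
theorem rowMass_one_le [Fintype X] (z : X) : ∑ w, ‖blockCLM₂ (1 : Module.End ℂ (X → 𝔸)) z w‖ ≤ 1 := by
  rw [Finset.sum_eq_single z (fun w _ hw => by rw [blockCLM₂_one, if_neg (Ne.symm hw), norm_zero])
    (fun h => absurd (Finset.mem_univ z) h), blockCLM₂_one, if_pos rfl]
  exact ContinuousLinearMap.norm_id_le

open Classical in
/-- the identity has column mass `≤ 1`. [cite: Balaban1985BackgroundPropagators, (3.185) p.432, bookkeeping] -/
theorem colMass_one_le [Fintype X] (w : X) : ∑ z, ‖blockCLM₂ (1 : Module.End ℂ (X → 𝔸)) z w‖ ≤ 1 := by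
  rw [Finset.sum_eq_single w (fun z _ hz => by rw [blockCLM₂_one, if_neg hz, norm_zero])
    (fun h => absurd (Finset.mem_univ w) h), blockCLM₂_one, if_pos rfl]
  exact ContinuousLinearMap.norm_id_le

open Classical in
/-- **BLOCKS OF A SECTOR SANDWICH** `P_S·T·P_S` (def-Y's `secY`): the `(z, w)` block of `T` if `z, w ∈ S`, else `0`.
[cite: Balaban1985BackgroundPropagators, p.427 («g … defined at bonds of Λ»), (3.185) p.432, bookkeeping] -/
theorem blockCLM_sec_sandwich [CompleteSpace 𝔸] (S : X → Prop) (T : Module.End ℂ (X → 𝔸)) (z w : X) :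
    blockCLM (secY 𝔸 S * T * secY 𝔸 S) z w = if S z ∧ S w then blockCLM T z w else 0 := by
  ext a
  rw [blockCLM_apply, Module.End.mul_apply, Module.End.mul_apply]
  by_cases hw : S w
  · have h1 : secY 𝔸 S (deltaY w a) = deltaY w a := by
      funext v
      by_cases hv : S v
      · exact secY_apply_of hv _
      · rw [secY_apply_of_not hv]
        have hvw : v ≠ w := fun hvw => hv (hvw ▸ hw)
        simp [deltaY, hvw]
    rw [h1]
    by_cases hz : S z
    · rw [secY_apply_of hz, if_pos ⟨hz, hw⟩, blockCLM_apply]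
    · rw [secY_apply_of_not hz, if_neg (fun h => hz h.1)]; rfl
  · have h0 : secY 𝔸 S (deltaY w a) = 0 := by
      funext v
      by_cases hv : S v
      · rw [secY_apply_of hv]
        have hvw : v ≠ w := fun hvw => hw (hvw ▸ hv)
        simp [deltaY, hvw]
      · exact secY_apply_of_not hv _
    rw [h0, map_zero, map_zero, if_neg (fun h => hw h.2)]
    rfl

/-- the sandwich does not increase block norms. [cite: Balaban1985BackgroundPropagators, (3.185) p.432, bookkeeping] -/
theorem norm_blockCLM_sec_sandwich_le [CompleteSpace 𝔸] (S : X → Prop) (T : Module.End ℂ (X → 𝔸)) (z w : X) :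
    ‖blockCLM (secY 𝔸 S * T * secY 𝔸 S) z w‖ ≤ ‖blockCLM T z w‖ := by
  rw [blockCLM_sec_sandwich]
  split_ifs
  · exact le_rfl
  · rw [norm_zero]; exact norm_nonneg _

/-- a nonzero block of the sandwich is a nonzero block of `T` (at a pair in `S × S`). [cite: Balaban1985BackgroundPropagators, (3.185) p.432, bookkeeping] -/
theorem blockCLM_ne_zero_of_sec_sandwich [CompleteSpace 𝔸] (S : X → Prop) (T : Module.End ℂ (X → 𝔸)) {z w : X}
    (h : blockCLM (secY 𝔸 S * T * secY 𝔸 S) z w ≠ 0) : blockCLM T z w ≠ 0 := by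
  rw [blockCLM_sec_sandwich] at h
  split_ifs at h with hzw
  · exact h
  · exact absurd rfl h

end Locality

/-! ## §3 At a member: `LocalOuterY` of the outer factors of (3.185) FROM letter-level locality of `D`, `μ`, `μ*`, `D*` -/

section Member

open Node00
open B6KLevelCensusIndexV1 (KIdx)
open B9PinMembersKLevelV1 (MemberY geo9Y bg9Y)
open B9PinGeometryKLevelV1 (kLab unitDistY inΛY)
open B9Thm314GpFlatTorusGeometry (tdistK)
open B9Thm314QGGQInvFlatTransfer (tdistK_triangle tdistK_comm)
open B9Thm314GpFlatOmegaOff (tdistK_self)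
open B9Thm315WholeSectERep (outerLY outerRY LocalOuterY)

variable {d ℓ : ℕ} {hd : 1 ≤ d + 1} {hL : Odd (ℓ + 1) ∧ 1 < ℓ + 1} {b₀ b₁ : ℝ} {Mstar : ℕ}
variable {𝔸 : Type} [NormedRing 𝔸] [NormedAlgebra ℂ 𝔸] [CompleteSpace 𝔸] [FiniteDimensional ℂ 𝔸]

/-- p21's k-block distance is a pseudo-distance on the position space `Fin (d+1) → ℤ` (the k-block labels).
[cite: Balaban1985BackgroundPropagators, (3.187) p.432 («|y − y′|»), dictionary] -/
theorem isPseudoDist_tdistK (x : MemberY d ℓ hd hL b₀ b₁ Mstar) :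
    IsPseudoDist (tdistK (ℓ := ℓ) (Mh := x.Mh) (k := x.k) (P := x.P') : (Fin (d + 1) → ℤ) → (Fin (d + 1) → ℤ) → ℝ) :=
  ⟨fun _ _ => tdistK_comm _ _, fun _ => tdistK_self _, fun _ _ _ => tdistK_triangle _ _ _⟩

/-- def-Y's `unitDistY` IS the k-block distance of the bonds' k-labels (`rfl`). [cite: Balaban1985BackgroundPropagators, (3.187) p.432, dictionary] -/
theorem unitDistY_eq_tdistK_kLab (x : MemberY d ℓ hd hL b₀ b₁ Mstar) (p q : IBondY x.toKIdx) :
    unitDistY x p q = tdistK (ℓ := ℓ) (Mh := x.Mh) (k := x.k) (P := x.P') (kLab x p) (kLab x q) := rfl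

/-- ★★ **`LocalOuterY` FROM LETTER-LEVEL LOCALITY** ((3.169): `μ` is local, `D` is one-step).  At a member `x` and a configuration `U`, place the index bonds
by their k-labels (def-Y's `kLab x`) and the sites by a placing `πS` of the supplier's choice into the k-block labels `Fin (d+1) → ℤ` with p21's distance
`tdistK`.  If the blocks of `D = 𝔢.Dbar U` (bond ← site) have range `≤ r_D` and row mass `≤ m_D`, those of `μ = 𝔢.mu U` (site ← bond) range `≤ r_μ` and row
mass `≤ m_μ` (`m_μ ≥ 0`), those of `μ* = 𝔢.muT U` (bond ← site) range `≤ r_{μ*}` and COLUMN mass `≤ m_{μ*}` (`≥ 0`), those of `D* = 𝔢.DbarT U` (site ← bond)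
range `≤ r_{D*}` and column mass `≤ m_{D*}`, then the outer factors `P_Λ(1 + Dμ)P_Λ`, `P_Λ(1 + μ*D*)P_Λ` satisfy the seat's `LocalOuterY x 𝔢 r (1 + m_Dm_μ)
(1 + m_{μ*}m_{D*}) U` along `unitDistY` with `r = max 0 (max (r_D + r_μ) (r_{μ*} + r_{D*}))` (§2: ranges add, masses multiply, the identity has range 0 and
mass ≤ 1, the `P_Λ` sandwich does not increase either). [cite: Balaban1985BackgroundPropagators, (3.169) p.430, (3.185) p.432] -/
theorem localOuterY_of_letters (x : MemberY d ℓ hd hL b₀ b₁ Mstar) (𝔢 : SectELettersY 𝔸 x) (U : CfgY 𝔸 x.toKIdx)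
    (πS : SiteY x.toKIdx → (Fin (d + 1) → ℤ)) {rD rμ rμT rDT mD mμ mμT mDT : ℝ} (hmμ : 0 ≤ mμ) (hmμT : 0 ≤ mμT)
    (hDr : ∀ (p : IBondY x.toKIdx) (s : SiteY x.toKIdx), blockCLM₂ (𝔢.Dbar U) p s ≠ 0 →
      tdistK (ℓ := ℓ) (Mh := x.Mh) (k := x.k) (P := x.P') (kLab x p) (πS s) ≤ rD)
    (hDm : ∀ p : IBondY x.toKIdx, ∑ s, ‖blockCLM₂ (𝔢.Dbar U) p s‖ ≤ mD)
    (hμr : ∀ (s : SiteY x.toKIdx) (q : IBondY x.toKIdx), blockCLM₂ (𝔢.mu U) s q ≠ 0 →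
      tdistK (ℓ := ℓ) (Mh := x.Mh) (k := x.k) (P := x.P') (πS s) (kLab x q) ≤ rμ)
    (hμm : ∀ s : SiteY x.toKIdx, ∑ q, ‖blockCLM₂ (𝔢.mu U) s q‖ ≤ mμ)
    (hμTr : ∀ (p : IBondY x.toKIdx) (s : SiteY x.toKIdx), blockCLM₂ (𝔢.muT U) p s ≠ 0 →
      tdistK (ℓ := ℓ) (Mh := x.Mh) (k := x.k) (P := x.P') (kLab x p) (πS s) ≤ rμT)
    (hμTm : ∀ s : SiteY x.toKIdx, ∑ p, ‖blockCLM₂ (𝔢.muT U) p s‖ ≤ mμT)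
    (hDTr : ∀ (s : SiteY x.toKIdx) (q : IBondY x.toKIdx), blockCLM₂ (𝔢.DbarT U) s q ≠ 0 →
      tdistK (ℓ := ℓ) (Mh := x.Mh) (k := x.k) (P := x.P') (πS s) (kLab x q) ≤ rDT)
    (hDTm : ∀ q : IBondY x.toKIdx, ∑ s, ‖blockCLM₂ (𝔢.DbarT U) s q‖ ≤ mDT) :
    LocalOuterY x 𝔢 (max 0 (max (rD + rμ) (rμT + rDT))) (1 + mD * mμ) (1 + mμT * mDT) U := by
  have hρ := isPseudoDist_tdistK x
  -- the two inner composites `1 + D∘μ`, `1 + μ*∘D*` on the index-bond carrier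
  have hL_range : ∀ p q : IBondY x.toKIdx, blockCLM₂ (1 + 𝔢.Dbar U ∘ₗ 𝔢.mu U) p q ≠ 0 →
      tdistK (ℓ := ℓ) (Mh := x.Mh) (k := x.k) (P := x.P') (kLab x p) (kLab x q) ≤ max 0 (rD + rμ) :=
    range_add (kLab x) (kLab x) (range_one hρ (kLab x)) (range_comp_le hρ (kLab x) πS (kLab x) hDr hμr)
  have hL_mass : ∀ p : IBondY x.toKIdx, ∑ q, ‖blockCLM₂ (1 + 𝔢.Dbar U ∘ₗ 𝔢.mu U) p q‖ ≤ 1 + mD * mμ :=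
    rowMass_add_le rowMass_one_le (rowMass_comp_le hmμ hDm hμm)
  have hR_range : ∀ p q : IBondY x.toKIdx, blockCLM₂ (1 + 𝔢.muT U ∘ₗ 𝔢.DbarT U) p q ≠ 0 →
      tdistK (ℓ := ℓ) (Mh := x.Mh) (k := x.k) (P := x.P') (kLab x p) (kLab x q) ≤ max 0 (rμT + rDT) :=
    range_add (kLab x) (kLab x) (range_one hρ (kLab x)) (range_comp_le hρ (kLab x) πS (kLab x) hμTr hDTr)
  have hR_mass : ∀ q : IBondY x.toKIdx, ∑ p, ‖blockCLM₂ (1 + 𝔢.muT U ∘ₗ 𝔢.DbarT U) p q‖ ≤ 1 + mμT * mDT :=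
    colMass_add_le colMass_one_le (colMass_comp_le hmμT hμTm hDTm)
  refine ⟨fun p q h => ?_, fun p => ?_, fun q p h => ?_, fun p => ?_⟩
  · have h' := blockCLM_ne_zero_of_sec_sandwich (inΛY x) _ h
    rw [← blockCLM₂_eq_blockCLM] at h'
    exact ((hL_range p q h').trans (max_le_max le_rfl (le_max_left _ _)))
  · have hL' : ∑ q, ‖blockCLM (1 + 𝔢.Dbar U ∘ₗ 𝔢.mu U) p q‖ ≤ 1 + mD * mμ := by
      simpa only [blockCLM₂_eq_blockCLM] using hL_mass p
    calc ∑ q, ‖blockCLM (outerLY x 𝔢 U) p q‖ ≤ ∑ q, ‖blockCLM (1 + 𝔢.Dbar U ∘ₗ 𝔢.mu U) p q‖ :=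
          Finset.sum_le_sum fun q _ => norm_blockCLM_sec_sandwich_le (inΛY x) _ p q
      _ ≤ 1 + mD * mμ := hL'
  · have h' := blockCLM_ne_zero_of_sec_sandwich (inΛY x) _ h
    rw [← blockCLM₂_eq_blockCLM] at h'
    exact ((hR_range q p h').trans (max_le_max le_rfl (le_max_right _ _)))
  · have hR' : ∑ q, ‖blockCLM (1 + 𝔢.muT U ∘ₗ 𝔢.DbarT U) q p‖ ≤ 1 + mμT * mDT := by
      simpa only [blockCLM₂_eq_blockCLM] using hR_mass p
    calc ∑ q, ‖blockCLM (outerRY x 𝔢 U) q p‖ ≤ ∑ q, ‖blockCLM (1 + 𝔢.muT U ∘ₗ 𝔢.DbarT U) q p‖ :=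
          Finset.sum_le_sum fun q _ => norm_blockCLM_sec_sandwich_le (inΛY x) _ q p
      _ ≤ 1 + mμT * mDT := hR'

end Member

end Literature.MathematicalPhysics.QuantumFieldTheory.Balaban1983to89.B9Thm315WholeBlocksRect

end
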